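import Summits.NavierStokesRegularity.NavierStokesRegularity.Theorems.ScenarioCensusHullMeterRows
import Summits.NavierStokesRegularity.NavierStokesRegularity.Theorems.TypeIQuarterGateScarEnvelopeTypeINearOneRateDss
import HarnessLib

/-!
# HULL METER port, part 4/4: §G″ (REV 3) the TWO-CENTRE defect dial — with a second centre COARSE factors are decided (`ctrRescale`, `CtrDefectVanishes`, `Row_A2hu2c`, `row_A2hu2c_holds` via the
# tree's one-centre rigidity `ScalingSpectrum.row_D2cT_holds` BY NAME, `universal_gap_twoCentre`, `rows_of_L'` / `rows_of_rung` extended); §I controls; census KEYS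

Re-homed for the scenario census (typer seat ns-census-typer-1 g10; the cells A2huN / A2huS / A2huR / A2huF / A2huC / A2huD / A2huDf / A2hu2c are MEMBERS OF RECORD «DECIDED IN KERNEL IN
FILES» of row A2 (item 76: REV 1 critic PASS, REV 3 idea-crit-3 g10 ROW WORDS BY KEY 11:55:14Z; ref PRE-CHECK ✓ §18.33; lead label LBL76r3), A2huL / A2huDL OPEN ≡ D7
(`CoarsePastLiouville`); this port makes the decided cells TREE-decided): VERBATIM PORT of ns-idea-2 LINE g17-1 «hull-meter» REV 3,
`pub/ideators/ns-idea-2/lines/hull-meter/line-hull-meter.rev3.lean` sha16 ab921f346883452d (1125 l., lean check rc 0, 0 sorry), split for the 400-line rule into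
`ScenarioCensusHullMeter` (§A–§C) → `…HullMeterDials` (§D–§F) → `…HullMeterRows` (§G, §H, §G′) → `…HullMeterTwoCentre` (§G″, §I + census KEYS).  Lean text VERBATIM in namespace
`…Theorems.ScenarioCensus.HullMeter` (the line's `…Lines.HullMeter` re-homed); port edits: the line's `local notation "E3"` is spelled as the reducible `abbrev E3` of every census
file; the line's import of the crux workfile `Cruxes/ScarEnvelopeTypeI/Lines/axis_activity` is replaced by its landed Theorems home
`Theorems.TypeIQuarterGateScarEnvelopeTypeINearOneRateDss` (same namespace `…Cruxes.ScarEnvelopeTypeI.AxisActivity`, same names `NearOneRateDss` / `nearOneRateDss_proof` /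
`isDiscretelySelfSimilar_pow`); `set_option linter.unusedVariables false` dropped (binders the linter names are `_`-prefixed); `@[conjecture]` on the OPEN statements `CoarsePastLiouville`,
`CoarseGapLaw`, `Row_A2huL`, `Row_A2huDL` (≡ census D7, OPEN); one-line docstrings added where missing (gate lint).  Statements untouched.

No census VALUE is moved here (row A2 stays OPEN-WITH-LINE; the members become TREE-decided by name); D7 / (L′) are NOT proved; no summit statement is proved by this file.
-/

-- the summit and its single problem share the name `NavierStokesRegularity` (D-0017 nested layout)
set_option linter.dupNamespace false

noncomputable section

open Set Function Filter Metric
open scoped Topology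
open Literature.Analysis Literature.Analysis.FluidPDE
open Summit.NavierStokesRegularity.NavierStokesRegularity.Theorems
open Summit.NavierStokesRegularity.NavierStokesRegularity.Theorems.ScenarioCensus.ScrewBlowdown
open Summit.NavierStokesRegularity.NavierStokesRegularity.Theorems.ScenarioCensus.ScalingSpectrum
open Summit.NavierStokesRegularity.NavierStokesRegularity.Theorems.PoloidalWindowDoorPoloidalWindowRigidityStrata
open Summit.NavierStokesRegularity.NavierStokesRegularity.Cruxes.ScarEnvelopeTypeI.AxisActivity
open Literature.ComputerArithmetic.BrentZimmermann2010.CommensurableBases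

namespace Summit.NavierStokesRegularity.NavierStokesRegularity.Theorems.ScenarioCensus.HullMeter

variable {C : ℝ} {u : ℝ → E3 → E3}

/-! ## G″. (REV 3) The TWO-CENTRE defect dial: with a SECOND CENTRE, COARSE factors are decided

The single-centre defect dial (§G′) at one COARSE factor is the open D7 wall (`row_A2huDL_iff`).  Move the dilation centre:
`ctrRescale ξ c v (t,x) = c • v(c²t, ξ + c(x − ξ))` is the parabolic dilation by `c` about the spatial centre `ξ` in SIMILARITY
variables (apex time 0; `ctrRescale 0 c = nsRescale c`).  If along ONE scale sequence the dilation defects of the zooms about TWO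
DISTINCT similarity centres `ξ₁ ≠ ξ₂` (ANY factors `c₁, c₂ ∈ (0,∞)∖{1}`, coarse allowed, equal allowed) die pointwise on one germ of
one slice, then `u ≡ 0`: the hull member extracted along a subsequence is DSS about both centres on the germ, on the past
(`ctrDss_of_germ` = `dss_of_germ` conjugated by a translation), its past truncation is two-centre DSS for all times, and the
tree's TWO-CENTRE row `ScenarioCensus.ScalingSpectrum.row_D2cT_holds` (g11, BY NAME: the commutator of the two dilations is a
non-zero TRANSLATION, census A13 periodic Liouville) kills it; one-limit Liouville kills `u`.  Row `Row_A2hu2c` (DECIDED) and the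
universal two-centre gap `universal_gap_twoCentre` (N1 datum).  CONTRAST (kernel-checked on both sides): ONE centre + one coarse
factor = D7 (OPEN, `row_A2huDL_iff`); TWO centres + the same coarse factor = DECIDED. -/

/-- Parabolic dilation by `c` about the spatial centre `ξ` (apex time `0`), in similarity variables. -/
def ctrRescale (ξ : E3) (c : ℝ) (v : ℝ → E3 → E3) : ℝ → E3 → E3 := fun t x => c • v (c ^ 2 * t) (ξ + c • (x - ξ))

/-- The centred rescaling, unfolded. -/
theorem ctrRescale_apply (ξ : E3) (c : ℝ) (v : ℝ → E3 → E3) (t : ℝ) (x : E3) :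
    ctrRescale ξ c v t x = c • v (c ^ 2 * t) (ξ + c • (x - ξ)) := rfl

/-- About the origin the centred dilation is the zoom. -/
theorem ctrRescale_zero (c : ℝ) (v : ℝ → E3 → E3) : ctrRescale 0 c v = nsRescale c v := by
  funext t x
  rw [ctrRescale_apply, nsRescale_apply, zero_add, sub_zero]

/-- The TWO-CENTRE reading: after zooming by `s k`, the dilation defect about the similarity centre `ξ` with factor `c` dies on the germ. -/
def CtrDefectVanishes (ξ : E3) (c : ℝ) (u : ℝ → E3 → E3) (s : ℕ → ℝ) (t₀ : ℝ) (U : Set E3) : Prop :=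
  ∀ x ∈ U, Tendsto (fun k => ctrRescale ξ c (nsRescale (s k) u) t₀ x - nsRescale (s k) u t₀ x) atTop (𝓝 0)

/-- About the origin the centred reading is the §G′ defect reading. -/
theorem ctrDefectVanishes_zero_iff {c : ℝ} {u : ℝ → E3 → E3} {s : ℕ → ℝ} {t₀ : ℝ} {U : Set E3} :
    CtrDefectVanishes 0 c u s t₀ U ↔ DefectVanishes c u s t₀ U := by
  have e : ∀ k, ctrRescale 0 c (nsRescale (s k) u) = nsRescale (c * s k) u := fun k => by
    rw [ctrRescale_zero, mul_comm, nsRescale_mul]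
  simp only [CtrDefectVanishes, DefectVanishes, e]

/-- **Germ ⇒ past for a centred dilation** (`dss_of_germ` conjugated by the translation `x ↦ x + ξ`, class translation covariance
`IsTypeIAncientMild.comp_add_right`). -/
theorem ctrDss_of_germ {W : ℝ → E3 → E3} (hW : IsTypeIAncientMild C W) {ξ : E3} {c : ℝ} (hc : 0 < c) {t₀ : ℝ} (ht₀ : t₀ < 0)
    {U : Set E3} (hU : IsOpen U) (hne : U.Nonempty) (heq : ∀ x ∈ U, ctrRescale ξ c W t₀ x = W t₀ x) :
    ∀ t < 0, ∀ x, ctrRescale ξ c W t x = W t x := by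
  set V : ℝ → E3 → E3 := fun t x => W t (x + ξ) with hV
  have hVc : IsTypeIAncientMild C V := IsTypeIAncientMild.comp_add_right hW ξ
  have hU' : IsOpen ((fun y : E3 => y + ξ) ⁻¹' U) := hU.preimage (continuous_id.add continuous_const)
  obtain ⟨x₀, hx₀⟩ := hne
  have hne' : ((fun y : E3 => y + ξ) ⁻¹' U).Nonempty := ⟨x₀ - ξ, by simpa using hx₀⟩
  have key : ∀ (t : ℝ) (y : E3), nsRescale c V t y = ctrRescale ξ c W t (y + ξ) := by
    intro t y
    rw [nsRescale_apply, ctrRescale_apply, hV]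
    simp only
    congr 2
    rw [add_sub_cancel_right, add_comm]
  have heq' : ∀ y ∈ (fun y : E3 => y + ξ) ⁻¹' U, nsRescale c V t₀ y = V t₀ y := by
    intro y hy
    rw [key, heq _ hy]
  intro t ht x
  have h := dss_of_germ hVc hc ht₀ hU' hne' heq' ht (x - ξ)
  rw [key, sub_add_cancel] at h
  rw [h, hV]
  simp only [sub_add_cancel]

/-- Past invariance under a centred dilation makes the past truncation DSS about that centre FOR ALL TIMES (tree `IsDssAbout`). -/
theorem isDssAbout_pastPart {W : ℝ → E3 → E3} {ξ : E3} {c : ℝ} (hc : 0 < c)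
    (h : ∀ t < 0, ∀ x, ctrRescale ξ c W t x = W t x) : IsDssAbout ξ c (pastPart W) := by
  intro t x
  by_cases ht : t < 0
  · have hct : c ^ 2 * t < 0 := mul_neg_of_pos_of_neg (by positivity) ht
    rw [pastPart_of_neg ht, pastPart_of_neg hct, ← ctrRescale_apply, h t ht x]
  · have hct : ¬ c ^ 2 * t < 0 := not_lt.2 (mul_nonneg (sq_nonneg c) (not_lt.1 ht))
    rw [pastPart_of_not_neg ht, pastPart_of_not_neg hct, smul_zero]

/-- **TWO-CENTRE PAST LIOUVILLE** (every `C`, ANY factors `≠ 1`): a field of `A_C` which is, on the past, DSS about two distinct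
centres vanishes on the past — the tree's `row_D2cT_holds` through the past truncation. -/
theorem eq_zero_of_twoCentre_pastInvariant {W : ℝ → E3 → E3} (hW : IsTypeIAncientMild C W) {ξ₁ ξ₂ : E3} (hξ : ξ₁ ≠ ξ₂)
    {c₁ c₂ : ℝ} (hc₁ : 0 < c₁) (hc₁1 : c₁ ≠ 1) (hc₂ : 0 < c₂) (hc₂1 : c₂ ≠ 1)
    (h₁ : ∀ t < 0, ∀ x, ctrRescale ξ₁ c₁ W t x = W t x) (h₂ : ∀ t < 0, ∀ x, ctrRescale ξ₂ c₂ W t x = W t x) :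
    ∀ t < 0, ∀ x, W t x = 0 := by
  intro t ht x
  have hz := row_D2cT_holds C (pastPart W) ξ₁ ξ₂ c₁ c₂ (isTypeIAncientMild_pastPart hW) hξ hc₁ hc₁1 hc₂.ne' hc₂1
    (isDssAbout_pastPart hc₁ h₁) (isDssAbout_pastPart hc₂ h₂) t ht x
  rwa [pastPart_of_neg ht] at hz

/-- **TWO-CENTRE DEFECT MASTER THEOREM** (coarse factors allowed).  If along ONE scale sequence `sₖ → ∞` the dilation defects of the
zooms about two distinct similarity centres `ξ₁ ≠ ξ₂`, with ANY factors `c₁, c₂ ∈ (0,∞)∖{1}`, tend to `0` pointwise on one nonempty open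
germ of one slice `t₀ < 0`, then `u ≡ 0` on the past. -/
theorem eq_zero_of_twoCentreDefect (hu : IsTypeIAncientMild C u) {s : ℕ → ℝ} (hspos : ∀ k, 0 < s k)
    (hslim : Tendsto s atTop atTop) {t₀ : ℝ} (ht₀ : t₀ < 0) {U : Set E3} (hU : IsOpen U) (hne : U.Nonempty)
    {ξ₁ ξ₂ : E3} (hξ : ξ₁ ≠ ξ₂) {c₁ c₂ : ℝ} (hc₁ : 0 < c₁) (hc₁1 : c₁ ≠ 1) (hc₂ : 0 < c₂) (hc₂1 : c₂ ≠ 1)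
    (h₁ : CtrDefectVanishes ξ₁ c₁ u s t₀ U) (h₂ : CtrDefectVanishes ξ₂ c₂ u s t₀ U) : ∀ t < 0, ∀ x, u t x = 0 := by
  obtain ⟨φ, hφ, W, hWh, hW, hpt, -⟩ := exists_hull_limit hu hspos hslim
  have hgerm : ∀ {ξ : E3} {c : ℝ}, 0 < c → CtrDefectVanishes ξ c u s t₀ U → ∀ x ∈ U, ctrRescale ξ c W t₀ x = W t₀ x := by
    intro ξ c hc hd x hx
    have hct : c ^ 2 * t₀ < 0 := mul_neg_of_pos_of_neg (by positivity) ht₀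
    have hA : Tendsto (fun j => ctrRescale ξ c (nsRescale (s (φ j)) u) t₀ x) atTop (𝓝 (ctrRescale ξ c W t₀ x)) := by
      show Tendsto (fun j => c • nsRescale (s (φ j)) u (c ^ 2 * t₀) (ξ + c • (x - ξ))) atTop
        (𝓝 (c • W (c ^ 2 * t₀) (ξ + c • (x - ξ))))
      exact (hpt _ hct _).const_smul c
    have hB : Tendsto (fun j => nsRescale (s (φ j)) u t₀ x +
        (ctrRescale ξ c (nsRescale (s (φ j)) u) t₀ x - nsRescale (s (φ j)) u t₀ x)) atTop (𝓝 (W t₀ x + 0)) :=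
      (hpt t₀ ht₀ x).add ((hd x hx).comp hφ.tendsto_atTop)
    rw [add_zero] at hB
    exact tendsto_nhds_unique hA (hB.congr fun j => by abel)
  exact eq_zero_of_zero_mem_hull hu hWh
    (eq_zero_of_twoCentre_pastInvariant hW hξ hc₁ hc₁1 hc₂ hc₂1 (ctrDss_of_germ hW hc₁ ht₀ hU hne (hgerm hc₁ h₁))
      (ctrDss_of_germ hW hc₂ ht₀ hU hne (hgerm hc₂ h₂)))

/-- **Row A2hu2c** («the dilation defects about TWO DISTINCT similarity centres, ANY factors ≠ 1, vanish pointwise on one slice-germ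
along ONE scale sequence» ⇒ `u ≡ 0`).  DECIDED (`row_A2hu2c_holds`).  Contrast: one centre + one coarse factor = `Row_A2huDL` = D7, OPEN. -/
def Row_A2hu2c : Prop :=
  ∀ (C : ℝ) (u : ℝ → E3 → E3), IsTypeIAncientMild C u →
    (∃ s : ℕ → ℝ, (∀ k, 0 < s k) ∧ Tendsto s atTop atTop ∧ ∃ t₀ < (0 : ℝ), ∃ U : Set E3, IsOpen U ∧ U.Nonempty ∧
      ∃ ξ₁ ξ₂ : E3, ξ₁ ≠ ξ₂ ∧ ∃ c₁ c₂ : ℝ, 0 < c₁ ∧ c₁ ≠ 1 ∧ 0 < c₂ ∧ c₂ ≠ 1 ∧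
        CtrDefectVanishes ξ₁ c₁ u s t₀ U ∧ CtrDefectVanishes ξ₂ c₂ u s t₀ U) →
    ∀ t < (0 : ℝ), ∀ x, u t x = 0

/-- **Row A2hu2c holds.** -/
theorem row_A2hu2c_holds : Row_A2hu2c := by
  rintro C u hu ⟨s, hspos, hslim, t₀, ht₀, U, hU, hne, ξ₁, ξ₂, hξ, c₁, c₂, hc₁, hc₁1, hc₂, hc₂1, h₁, h₂⟩
  exact eq_zero_of_twoCentreDefect hu hspos hslim ht₀ hU hne hξ hc₁ hc₁1 hc₂ hc₂1 h₁ h₂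

/-- The two-centre row with BOTH centres equal to the origin and factors `2, 3` is NOT what decides `Row_A2huD` (that needs the
`log 2 / log 3` arithmetic); but the two-centre row DOES contain the coarse single-factor reading taken about two centres:
`Row_A2hu2c` gives, for every `λ > 1`, the cell «λ-defects about `0` AND about some `ξ ≠ 0` both die» — decided, while about `0` alone it is D7. -/
theorem twoCentre_sameFactor_decided (h : Row_A2hu2c) (C : ℝ) (u : ℝ → E3 → E3) (hu : IsTypeIAncientMild C u)
    {lam : ℝ} (hlam : 1 < lam) {s : ℕ → ℝ} (hspos : ∀ k, 0 < s k) (hslim : Tendsto s atTop atTop) {t₀ : ℝ} (ht₀ : t₀ < 0)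
    {U : Set E3} (hU : IsOpen U) (hne : U.Nonempty) {ξ : E3} (hξ : ξ ≠ 0)
    (h0 : DefectVanishes lam u s t₀ U) (hξd : CtrDefectVanishes ξ lam u s t₀ U) : ∀ t < 0, ∀ x, u t x = 0 :=
  h C u hu ⟨s, hspos, hslim, t₀, ht₀, U, hU, hne, 0, ξ, hξ.symm, lam, lam, one_pos.trans hlam, ne_of_gt hlam,
    one_pos.trans hlam, ne_of_gt hlam, ctrDefectVanishes_zero_iff.2 h0, hξd⟩

/-- **THE UNIVERSAL TWO-CENTRE GAP** (every `C`, every pair of distinct similarity centres, ANY factors `≠ 1` — the N1 datum of REV 3):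
there is `δ = δ(C, ξ₁, ξ₂, c₁, c₂) > 0` such that every non-trivial `u ∈ A_C` has, at ALL sufficiently large scales `μ`, a point of
`B₁ × {−1}` where ONE of the two centred dilation defects of `u_μ` exceeds `δ`. -/
theorem universal_gap_twoCentre (C : ℝ) {ξ₁ ξ₂ : E3} (hξ : ξ₁ ≠ ξ₂) {c₁ c₂ : ℝ} (hc₁ : 0 < c₁) (hc₁1 : c₁ ≠ 1)
    (hc₂ : 0 < c₂) (hc₂1 : c₂ ≠ 1) :
    ∃ δ : ℝ, 0 < δ ∧ ∀ u : ℝ → E3 → E3, IsTypeIAncientMild C u → (∃ t < (0 : ℝ), ∃ x, u t x ≠ 0) →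
      ∃ μ₁ : ℝ, 0 < μ₁ ∧ ∀ μ : ℝ, μ₁ ≤ μ → ∃ x : E3, ‖x‖ < 1 ∧
        (δ < ‖ctrRescale ξ₁ c₁ (nsRescale μ u) (-1) x - nsRescale μ u (-1) x‖ ∨
         δ < ‖ctrRescale ξ₂ c₂ (nsRescale μ u) (-1) x - nsRescale μ u (-1) x‖) := by
  by_contra H
  push Not at H
  obtain ⟨ε, hε, K, hK, hsub⟩ := substantial_at_large_scales C
  have hδn : ∀ n : ℕ, (0 : ℝ) < 1 / ((n : ℝ) + 1) := fun n => by positivity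
  choose v hv hvne hvsmall using fun n : ℕ => H _ (hδn n)
  choose μ₁ hμ₁ hloud using fun n => hsub (v n) (hv n) (hvne n)
  choose μ hμge hsmall using fun n => hvsmall n (μ₁ n) (hμ₁ n)
  have hμpos : ∀ n, 0 < μ n := fun n => (hμ₁ n).trans_le (hμge n)
  have hw : ∀ n, IsTypeIAncientMild C (nsRescale (μ n) (v n)) := fun n => zoom_isTypeIAncientMild (hv n) (hμpos n)
  obtain ⟨φ, hφ, W, hW, hpt, -, hloc, -⟩ := exists_tendsto_of_isTypeIAncientMild_seq C hw
  have hbound : Tendsto (fun j : ℕ => 1 / ((φ j : ℝ) + 1)) atTop (𝓝 0) :=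
    tendsto_const_nhds.div_atTop
      ((tendsto_natCast_atTop_atTop.comp hφ.tendsto_atTop).atTop_add tendsto_const_nhds)
  -- (i) the limit is invariant on the germ `B₁ × {−1}` under BOTH centred dilations
  have hgerm : ∀ (ξ : E3) (c : ℝ), 0 < c →
      (∀ n, ∀ x : E3, ‖x‖ < 1 → ‖ctrRescale ξ c (nsRescale (μ n) (v n)) (-1) x - nsRescale (μ n) (v n) (-1) x‖ ≤ 1 / ((n : ℝ) + 1)) →
      ∀ x ∈ ball (0 : E3) 1, ctrRescale ξ c W (-1) x = W (-1) x := by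
    intro ξ c hc hsm x hx
    rw [mem_ball_zero_iff] at hx
    have hct : c ^ 2 * (-1 : ℝ) < 0 := mul_neg_of_pos_of_neg (by positivity) (by norm_num)
    have hA : Tendsto (fun j => ctrRescale ξ c (nsRescale (μ (φ j)) (v (φ j))) (-1) x) atTop
        (𝓝 (ctrRescale ξ c W (-1) x)) := by
      show Tendsto (fun j => c • nsRescale (μ (φ j)) (v (φ j)) (c ^ 2 * (-1)) (ξ + c • (x - ξ))) atTop
        (𝓝 (c • W (c ^ 2 * (-1)) (ξ + c • (x - ξ))))
      exact (hpt _ hct _).const_smul c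
    have hB : Tendsto (fun j => nsRescale (μ (φ j)) (v (φ j)) (-1) x) atTop (𝓝 (W (-1) x)) := hpt _ (by norm_num) _
    have hle : ‖ctrRescale ξ c W (-1) x - W (-1) x‖ ≤ 0 :=
      le_of_tendsto_of_tendsto' (hA.sub hB).norm hbound fun j => hsm (φ j) x hx
    exact sub_eq_zero.1 (norm_le_zero_iff.1 hle)
  have hinv₁ := ctrDss_of_germ hW hc₁ (by norm_num : (-1 : ℝ) < 0) isOpen_ball ⟨0, mem_ball_self one_pos⟩
    (hgerm ξ₁ c₁ hc₁ fun n x hx => (hsmall n x hx).1)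
  have hinv₂ := ctrDss_of_germ hW hc₂ (by norm_num : (-1 : ℝ) < 0) isOpen_ball ⟨0, mem_ball_self one_pos⟩
    (hgerm ξ₂ c₂ hc₂ fun n x hx => (hsmall n x hx).2)
  -- (ii) two-centre past Liouville
  have hW0 : ∀ t < 0, ∀ x, W t x = 0 := eq_zero_of_twoCentre_pastInvariant hW hξ hc₁ hc₁1 hc₂ hc₂1 hinv₁ hinv₂
  -- (iii) but the normalised fields are uniformly loud on `B̄_K × {−1}`
  have hK' : IsCompact (closedBall (0 : E3) K) := isCompact_closedBall _ _
  have hunif : TendstoUniformlyOn (fun j => nsRescale (μ (φ j)) (v (φ j)) (-1)) (W (-1)) atTop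
      (closedBall (0 : E3) K) :=
    (tendstoLocallyUniformlyOn_iff_tendstoUniformlyOn_of_compact hK').1
      (hloc (-1) (by norm_num)).tendstoLocallyUniformlyOn
  obtain ⟨j, hj⟩ := ((Metric.tendstoUniformlyOn_iff.1 hunif) ε hε).exists
  obtain ⟨y, hyK, hbig⟩ := hloud (φ j) (μ (φ j)) (hμge (φ j))
  have hyj : y ∈ closedBall (0 : E3) K := by rw [mem_closedBall, dist_zero_right]; exact hyK
  have h1 := hj y hyj
  rw [hW0 (-1) (by norm_num) y, dist_zero_left] at h1
  exact absurd h1 (not_lt.2 hbig.le)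

/-- **Reading** (asymptotic uniqueness of the centre): for every `λ > 1` and `ξ ≠ 0` there is `δ > 0` such that every nonzero `u ∈ A_C`
keeps, at all large scales, its `λ`-defect about `0` OR its `λ`-defect about `ξ` above `δ` somewhere on `B₁ × {−1}` — a candidate blow-down
can look approximately `λ`-DSS about at most ONE similarity centre. -/
theorem universal_gap_secondCentre (C : ℝ) {lam : ℝ} (hlam : 1 < lam) {ξ : E3} (hξ : ξ ≠ 0) :
    ∃ δ : ℝ, 0 < δ ∧ ∀ u : ℝ → E3 → E3, IsTypeIAncientMild C u → (∃ t < (0 : ℝ), ∃ x, u t x ≠ 0) →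
      ∃ μ₁ : ℝ, 0 < μ₁ ∧ ∀ μ : ℝ, μ₁ ≤ μ → ∃ x : E3, ‖x‖ < 1 ∧
        (δ < ‖nsRescale (lam * μ) u (-1) x - nsRescale μ u (-1) x‖ ∨
         δ < ‖ctrRescale ξ lam (nsRescale μ u) (-1) x - nsRescale μ u (-1) x‖) := by
  have hpos : 0 < lam := one_pos.trans hlam
  obtain ⟨δ, hδ, G⟩ := universal_gap_twoCentre C (ξ₁ := 0) (ξ₂ := ξ) hξ.symm hpos (ne_of_gt hlam) hpos (ne_of_gt hlam)
  refine ⟨δ, hδ, fun u hu hne => ?_⟩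
  obtain ⟨μ₁, hμ₁, G1⟩ := G u hu hne
  refine ⟨μ₁, hμ₁, fun μ hμ => ?_⟩
  obtain ⟨x, hx, h⟩ := G1 μ hμ
  refine ⟨x, hx, ?_⟩
  rwa [ctrRescale_zero, ← nsRescale_mul, mul_comm] at h

/-- (L′) settles every row and the open coarse statements (they all conclude `u ≡ 0` for members of `A_C`). -/
theorem rows_of_L' (hL : ∀ (C : ℝ) (u : ℝ → E3 → E3), IsTypeIAncientMild C u → ∀ t < 0, ∀ x, u t x = 0) :
    Row_A2huN ∧ Row_A2huS ∧ Row_A2huR ∧ Row_A2huF ∧ Row_A2huL ∧ Row_A2huC ∧ CoarsePastLiouville ∧ CoarseGapLaw ∧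
      Row_A2huD ∧ Row_A2huDf ∧ Row_A2huDL ∧ Row_A2hu2c := by
  refine ⟨fun C u hu _ => hL C u hu, fun C u hu _ => hL C u hu, fun C u hu _ => hL C u hu,
    fun C => ⟨2, one_lt_two, fun u hu _ => hL C u hu⟩, fun C u hu _ => hL C u hu, fun C u hu _ => hL C u hu,
    fun C lam _ W hW _ => hL C W hW, ?_, fun C u hu _ => hL C u hu, fun C => ⟨2, one_lt_two, fun u hu _ => hL C u hu⟩,
    fun C u hu _ => hL C u hu, fun C u hu _ => hL C u hu⟩
  exact coarseGapLaw_iff.2 fun C lam _ W hW _ => hL C W hW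

/-- **The rung** ⟨stmt-NavierStokesRegularity-10661⟩ `Theses.SymmetryModuliCount.TypeIAncientLiouville` (L′) decides every row. -/
theorem rows_of_rung (hL : Theses.SymmetryModuliCount.TypeIAncientLiouville) :
    Row_A2huN ∧ Row_A2huS ∧ Row_A2huR ∧ Row_A2huF ∧ Row_A2huL ∧ Row_A2huC ∧ CoarsePastLiouville ∧ CoarseGapLaw ∧
      Row_A2huD ∧ Row_A2huDf ∧ Row_A2huDL ∧ Row_A2hu2c :=
  rows_of_L' fun C u hu => hL C u (isTypeIAncientMild_iff.1 hu)

/-! ## I. Controls (the hypotheses of the rows are not vacuous; the OPEN row is met by every DSS element) -/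

/-- CONTROL: the zero field's zooms converge along every scale filter (so every convergence row has a client). -/
theorem control_zero_converges (l : Filter ℝ) (t₀ : ℝ) (x : E3) :
    Tendsto (fun s : ℝ => nsRescale s (fun _ _ => (0 : E3)) t₀ x) l (𝓝 0) := by
  simp only [nsRescale_apply, smul_zero]
  exact tendsto_const_nhds

/-- CONTROL: a (class-dropped) globally `λ₀`-DSS field meets the hypothesis of the coarse-lacunary row on EVERY germ —
the OPEN row A2huL is therefore exactly as hard as excluding such elements of `A_C` (`row_A2huL_iff`). -/
theorem control_dss_lacunary {lam : ℝ} {v : ℝ → E3 → E3} (h : IsDiscretelySelfSimilar lam v) (t₀ : ℝ) (x : E3) :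
    Tendsto (fun k : ℕ => nsRescale (lam ^ k) v t₀ x) atTop (𝓝 (v t₀ x)) := by
  have hk : ∀ k : ℕ, nsRescale (lam ^ k) v = v := fun k =>
    Cruxes.ScarEnvelopeTypeI.AxisActivity.isDiscretelySelfSimilar_pow h k
  simp_rw [hk]
  exact tendsto_const_nhds

/-- CONTROL: a (class-dropped) `λ₀`-DSS field has ZERO `λ₀`-zoom defect at every scale — the single-coarse-factor gap
law cannot be improved to hold for DSS-admissible classes; in `A_C` it is exactly `CoarsePastLiouville` (`coarseGapLaw_iff`). -/
theorem control_dss_zero_defect {lam μ : ℝ} {v : ℝ → E3 → E3} (h : IsDiscretelySelfSimilar lam v) (t : ℝ) (x : E3) :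
    nsRescale (lam * μ) v t x - nsRescale μ v t x = 0 := by
  have e : nsRescale lam v = v := h
  rw [nsRescale_mul, e, sub_self]

/-- CONTROL (non-vacuity of the cardinality row): the zero field's hull, modulo the past, is the single point `0` — so
`Row_A2huC` has a client, and «countable past-hull» is a genuine CONDITION (met by `0`, failed by every `u ≢ 0` in `A_C`
by `row_A2huC_holds`). -/
theorem control_pastHull_zero (hC : 0 ≤ C) : pastHull C (0 : ℝ → E3 → E3) = {(0 : ℝ → E3 → E3)} := by
  apply Set.eq_singleton_iff_unique_mem.2 ⟨?_, ?_⟩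
  · refine ⟨0, mem_hull.2 ⟨isTypeIAncientMild_zero hC, fun k => (k : ℝ) + 1, fun k => by positivity,
      tendsto_natCast_atTop_atTop.atTop_add tendsto_const_nhds, fun t ht => ?_⟩, ?_⟩
    · refine Metric.tendstoLocallyUniformly_iff.2 fun ε hε x => ⟨univ, univ_mem, Eventually.of_forall fun n y _ => ?_⟩
      simpa [nsRescale_apply] using hε
    · funext t x
      by_cases ht : t < 0
      · rw [pastPart_of_neg ht]
      · rw [pastPart_of_not_neg ht]; rfl
  · rintro _ ⟨W, hW, rfl⟩
    obtain ⟨-, μ, -, -, hconv⟩ := mem_hull.1 hW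
    funext t x
    by_cases ht : t < 0
    · rw [pastPart_of_neg ht]
      have h1 := (hconv t ht).tendstoLocallyUniformlyOn.tendsto_at (mem_univ x)
      have h2 : Tendsto (fun k => nsRescale (μ k) (0 : ℝ → E3 → E3) t x) atTop (𝓝 0) := by
        simp only [nsRescale_apply, Pi.zero_apply, smul_zero]
        exact tendsto_const_nhds
      simpa using tendsto_nhds_unique h1 h2
    · rw [pastPart_of_not_neg ht]; rfl

/-- Control: the zero field meets the hypothesis of row A2huC. -/
theorem control_row_A2huC_client (hC : 0 ≤ C) : (pastHull C (0 : ℝ → E3 → E3)).Countable := by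
  rw [control_pastHull_zero hC]; exact countable_singleton _

end Summit.NavierStokesRegularity.NavierStokesRegularity.Theorems.ScenarioCensus.HullMeter

namespace Summit.NavierStokesRegularity.NavierStokesRegularity.Theorems.ScenarioCensus

/-! ## Census KEYS (ns `…Theorems.ScenarioCensus`): instrument HULL METER (block A2) — TREE-decided cells A2huN / A2huS / A2huR / A2huF / A2huC / A2huD / A2huDf / A2hu2c, OPEN rows A2huL / A2huDL (≡ D7) -/

/-- **Cell A2huN** (ℕ-convergent blow-down: integer zooms converging on one slice-germ ⇒ `u ≡ 0`): `:= HullMeter.Row_A2huN`. DECIDED. -/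
def Row_A2huN : Prop := HullMeter.Row_A2huN
/-- A2huN is EXCLUDED (decided in the tree): `HullMeter.row_A2huN_holds`. -/
theorem row_A2huN_excluded : Row_A2huN := HullMeter.row_A2huN_holds

/-- **Cell A2huS** (zooms converging along an unbounded ×2,×3-stable scale set on one slice-germ ⇒ `u ≡ 0`): `:= HullMeter.Row_A2huS`. DECIDED. -/
def Row_A2huS : Prop := HullMeter.Row_A2huS
/-- A2huS is EXCLUDED (decided in the tree): `HullMeter.row_A2huS_holds`. -/
theorem row_A2huS_excluded : Row_A2huS := HullMeter.row_A2huS_holds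

/-- **Cell A2huR** (full convergence of the zooms `μ → ∞` on one slice-germ — «asymptotically self-similar» ⇒ `u ≡ 0`): `:= HullMeter.Row_A2huR`. DECIDED. -/
def Row_A2huR : Prop := HullMeter.Row_A2huR
/-- A2huR is EXCLUDED (decided in the tree): `HullMeter.row_A2huR_holds`. -/
theorem row_A2huR_excluded : Row_A2huR := HullMeter.row_A2huR_holds

/-- **Cell A2huF** (FINE lacunary zooms `λ^k`, `1 < λ < c₁(C)`, converging on one slice-germ ⇒ `u ≡ 0`): `:= HullMeter.Row_A2huF`. DECIDED. -/
def Row_A2huF : Prop := HullMeter.Row_A2huF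
/-- A2huF is EXCLUDED (decided in the tree): `HullMeter.row_A2huF_holds`. -/
theorem row_A2huF_excluded : Row_A2huF := HullMeter.row_A2huF_holds

/-- **Cell A2huC** (countable blow-down hull modulo the past ⇒ `u ≡ 0`): `:= HullMeter.Row_A2huC`. DECIDED. -/
def Row_A2huC : Prop := HullMeter.Row_A2huC
/-- A2huC is EXCLUDED (decided in the tree): `HullMeter.row_A2huC_holds`. -/
theorem row_A2huC_excluded : Row_A2huC := HullMeter.row_A2huC_holds

/-- **Cell A2huD** (REV 2 · zoom DEFECTS by the factors 2 and 3 vanishing along ONE scale sequence on one slice-germ ⇒ `u ≡ 0`): `:= HullMeter.Row_A2huD`. DECIDED. -/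
def Row_A2huD : Prop := HullMeter.Row_A2huD
/-- A2huD is EXCLUDED (decided in the tree): `HullMeter.row_A2huD_holds`. -/
theorem row_A2huD_excluded : Row_A2huD := HullMeter.row_A2huD_holds

/-- **Cell A2huDf** (REV 2 · zoom defect by a FINE factor vanishing along one sequence ⇒ `u ≡ 0`): `:= HullMeter.Row_A2huDf`. DECIDED. -/
def Row_A2huDf : Prop := HullMeter.Row_A2huDf
/-- A2huDf is EXCLUDED (decided in the tree): `HullMeter.row_A2huDf_holds`. -/
theorem row_A2huDf_excluded : Row_A2huDf := HullMeter.row_A2huDf_holds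

/-- **Cell A2hu2c** (REV 3 · centred zoom defects about TWO distinct centres, any factors `0 < cᵢ ≠ 1`, vanishing along one sequence on one slice-germ ⇒ `u ≡ 0`): `:= HullMeter.Row_A2hu2c`. DECIDED. -/
def Row_A2hu2c : Prop := HullMeter.Row_A2hu2c
/-- A2hu2c is EXCLUDED (decided in the tree): `HullMeter.row_A2hu2c_holds`. -/
theorem row_A2hu2c_excluded : Row_A2hu2c := HullMeter.row_A2hu2c_holds

/-- **Row A2huL** (COARSE lacunary zooms, any `λ > 1`) — typed only, ≡ `HullMeter.CoarsePastLiouville` (census D7, past form; `HullMeter.row_A2huL_iff`): `:= HullMeter.Row_A2huL`. OPEN. -/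
@[conjecture] def Row_A2huL : Prop := HullMeter.Row_A2huL

/-- **Row A2huDL** (REV 2 · coarse-factor zoom defect) — typed only, ≡ `HullMeter.CoarsePastLiouville` (`HullMeter.row_A2huDL_iff`): `:= HullMeter.Row_A2huDL`. OPEN. -/
@[conjecture] def Row_A2huDL : Prop := HullMeter.Row_A2huDL

/-- Lattice edges at key level: A2huS → A2huR, A2huD → A2huN, A2huDL → A2huL, A2huL → A2huF (`HullMeter.row_A2huR_of_row_A2huS` / `row_A2huN_of_D` / `row_A2huL_of_DL` / `row_A2huL_of_coarse`). -/
theorem row_A2huR_of_row_A2huS : Row_A2huS → Row_A2huR := HullMeter.row_A2huR_of_row_A2huS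
/-- See `row_A2huR_of_row_A2huS`. -/
theorem row_A2huN_of_row_A2huD : Row_A2huD → Row_A2huN := HullMeter.row_A2huN_of_D
/-- See `row_A2huR_of_row_A2huS`. -/
theorem row_A2huL_of_row_A2huDL : Row_A2huDL → Row_A2huL := HullMeter.row_A2huL_of_DL
/-- See `row_A2huR_of_row_A2huS`. -/
theorem row_A2huF_of_row_A2huL : Row_A2huL → Row_A2huF := HullMeter.row_A2huL_of_coarse

end Summit.NavierStokesRegularity.NavierStokesRegularity.Theorems.ScenarioCensus

end
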